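import Summits.BirchSwinnertonDyer.BirchSwinnertonDyer.Theorems.ConjSpanGenAllLevels
import HarnessLib

/-!
# Crux `X11aLowerHalf` (item stmt-BirchSwinnertonDyer-19064), stub `stub_muAnDeepFive` side — the ATKIN–LEHNER-EXTENDED
# ORBIT SETUP in `GL₂(ℤ[1/p])` at a multiplicative prime `p ∥ N`, ANY prime `p`, part 1/3 (objects, `Γ*`, normal form)

Cell `bsd-print-x11a`, width seat bsd-line-x11a-p1-w2 g3 (`--supports stmt-BirchSwinnertonDyer-19064`). BSD is not proved by
any of this; nothing is asserted about any curve. Route-independent group theory (imports: the tree's THEOREM-B files only).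

WHY. Seat bsd-line-x11a-p2 g2 proved Greenberg's analytic `μ₃ = 0` at a MULTIPLICATIVE `3` for residually irreducible `E`
(`MultThreeMuAn.muAnZeroAt_three_of_mult_of_irr`) by an Atkin–Lehner-extended orbit trick in `GL₂(ℤ[1/3])`
(`Theorems/PrintX11aMultThree{OrbitDefs,OrbitDecomposition,OrbitKernel}.lean`), written for the literal prime `3` but, as
its memo `Cruxes/UpperNonSurjThree/Lines/finemu3-muroad-orbit-trick.md` §p-GENERICITY says, p-generic in structure.  THIS
SERIES (`…MultOrbit{Defs,Decomposition,Kernel}`, `…MultAtkinLehnerPeriods`, `…MultWinding`) is that argument over `ℤ[1/p]`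
for an ARBITRARY prime `p ∥ N` (the one non-literal change: the coset splitting of `Γ₀(M)` modulo `Γ₀(pM)` uses an inverse
`c'` of `c` modulo `p` in place of `c² ≡ 1 (3)`).  Its output (`…MultWinding`): at a multiplicative ODD prime `p` with `E[p]`
irreducible SOME plus symbol `[u/pᵏ]⁺_f`, `k ≥ 1`, `p ∤ u`, is a `p`-adic unit — the EVEN Mazur–Tate–Teitelbaum measure of
`E` on `ℤ_pˣ` is not divisible by `p` ("some even tame branch has `μ = 0`").  HONEST SCOPE: for `p ≥ 5` this is NOT the
`ω⁰`-branch statement `X11a.MuAnZeroAt` of the registered stub `stub_muAnDeepFive` (Greenberg's Conj. 1.11 on that branch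
stays OPEN class-wide); it is the provable «some even branch» half, the multiplicative twin of the tree's input-free AN-11/AN-13
at good `p` (`PrintX9EvenBranchMuZeroInputFree`).

At a multiplicative level `N = pM` (`p ∤ M`) the tree's THEOREM B span statement is vacuous and `Γ₀(pM)` has TWO orbits on
`Δ·∞` and on `Δ·0` for `Δ = Γ₀(M; ℤ[1/p])` (cusp classes `[∞] ∪ [1/M]`, `[0] ∪ [1/p]`); the REPAIR is to pass to
`G = GL₂(ℤ[1/p])` and `Γ* = ⟨Γ₀(pM), W⟩`, `W = w(p) = (px, y; pM, p)` the Atkin–Lehner matrix (`det W = p`, a unit of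
`ℤ[1/p]`): `W` swaps `[∞] ↔ [1/M]` and `[0] ↔ [1/p]`, so `Γ*` is transitive and the tree's ABSTRACT orbit lemma
`ConjSpanGenAllLevels.OrbitTrick.mem_of_mem_closure` applies with `D* = {c ∈ M·ℤ[1/p]} ≤ GL₂`, `B* =` upper, `P* =` lower.

THIS FILE (1/3): `A = ℤ[1/p]`, `G = GL₂(A)`; the unit `p`, `sP = p·1`, `diag2 u v`; the integer matrix `Wint p M x y`,
`ξ' = (x y; M p) ∈ SL₂(ℤ)` (`px − My = 1`), `W = mapGL ξ' · diag(p,1) ∈ G`; the subgroups `B*`, `P*_M`, `D*_M`;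
`Γ* := ⟨mapGL Γ₀(N) ∪ {W}⟩`; and the NORMAL FORM `g = pᵏ · γ · Wⁱ` (`k ∈ ℤ`, `γ ∈ Γ₀(N)`, `i ∈ {0,1}`) of every element
of `Γ*`, from the two integer identities `γ^W · W = W · γ` (`W` normalises `Γ₀(N)`) and `W·W = p·γ₀` (hypotheses here;
discharged from Knapp 1993 Lemma 9.24 in `…MultAtkinLehnerPeriods`).  VERBATIM the p2 g2 file with `3 ↦ p`.
beyond-print: the multiplicative-level orbit trick is not in print (nearest: Sun 2007 §4; Kim–Sun).
References: [Vaserstein1972SL2] Theorem; [Manin1972] Prop. 1.4; [Knapp1993] Lemma 9.24, Thm. 9.27; [AtkinLehner1970]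
Lemmas 8–10, Thm. 3.
-/

set_option linter.dupNamespace false
set_option autoImplicit false

namespace Summit.BirchSwinnertonDyer.BirchSwinnertonDyer.Theorems.MultOrbit

open scoped MatrixGroups
open CongruenceSubgroup Matrix.SpecialLinearGroup
open Summit.BirchSwinnertonDyer.BirchSwinnertonDyer.Theorems.ConjSpanGenAllLevels
  Literature.NumberTheory.EllipticCurves.Rank1Residual

noncomputable section

/-- `A = ℤ[1/p]`. -/
abbrev A (p : ℕ) : Type := Away p

/-- `G = GL₂(ℤ[1/p])`. -/
abbrev G (p : ℕ) : Type := GL (Fin 2) (A p)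

variable {p : ℕ}

/-! ### The unit `p`, the scalar and diagonal matrices, and `W` -/

/-- `p` is a unit of `ℤ[1/p]`. [folklore] -/
theorem isUnit_natCast (p : ℕ) : IsUnit ((p : ℤ) : A p) := by
  have h := IsLocalization.Away.algebraMap_isUnit (S := A p) (p : ℤ)
  simpa using h

/-- The unit `p ∈ ℤ[1/p]ˣ`. [folklore] -/
def pU (p : ℕ) : (A p)ˣ := (isUnit_natCast p).unit

/-- The unit `p` coerces to `p`. [folklore] -/
@[simp] theorem coe_pU (p : ℕ) : ((pU p : (A p)ˣ) : A p) = ((p : ℤ) : A p) := (isUnit_natCast p).unit_spec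

/-- The scalar matrix `p·1 ∈ GL₂(ℤ[1/p])`. [folklore] -/
def sP (p : ℕ) : G p := Matrix.GeneralLinearGroup.scalar (Fin 2) (pU p)

/-- The diagonal matrix `diag(u, v) ∈ GL₂(ℤ[1/p])` for units `u, v`. [folklore] -/
def diag2 (u v : (A p)ˣ) : G p :=
  ⟨!![(u : A p), 0; 0, (v : A p)], !![((u⁻¹ : (A p)ˣ) : A p), 0; 0, ((v⁻¹ : (A p)ˣ) : A p)],
    by
      ext i j
      fin_cases i <;> fin_cases j <;> simp [Matrix.mul_apply, Fin.sum_univ_two],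
    by
      ext i j
      fin_cases i <;> fin_cases j <;> simp [Matrix.mul_apply, Fin.sum_univ_two]⟩

/-- Entry `(0,0)` of `diag(u,v)`. [folklore] -/
@[simp] theorem diag2_apply_00 (u v : (A p)ˣ) : (diag2 u v : G p) 0 0 = (u : A p) := rfl
/-- Entry `(0,1)` of `diag(u,v)`. [folklore] -/
@[simp] theorem diag2_apply_01 (u v : (A p)ˣ) : (diag2 u v : G p) 0 1 = 0 := rfl
/-- Entry `(1,0)` of `diag(u,v)`. [folklore] -/
@[simp] theorem diag2_apply_10 (u v : (A p)ˣ) : (diag2 u v : G p) 1 0 = 0 := rfl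
/-- Entry `(1,1)` of `diag(u,v)`. [folklore] -/
@[simp] theorem diag2_apply_11 (u v : (A p)ˣ) : (diag2 u v : G p) 1 1 = (v : A p) := rfl

/-- `det diag(u, v) = u v`. [folklore] -/
theorem det_diag2 (u v : (A p)ˣ) : Matrix.GeneralLinearGroup.det (diag2 u v) = u * v := by
  ext
  rw [Matrix.GeneralLinearGroup.val_det_apply, Units.val_mul]
  show Matrix.det !![(u : A p), 0; 0, (v : A p)] = _
  rw [Matrix.det_fin_two_of]; ring

/-- The diagonal matrix `diag(p, 1) ∈ GL₂(ℤ[1/p])`. [folklore] -/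
abbrev dP1 (p : ℕ) : G p := diag2 (pU p) 1

section Setup

variable (p) (M : ℕ) (x y : ℤ)

/-- The INTEGER Atkin–Lehner matrix `W = (px, y; pM, p)` (determinant `p` when `px − My = 1`). [folklore] -/
def Wint : Matrix (Fin 2) (Fin 2) ℤ := !![(p : ℤ) * x, y; (p : ℤ) * (M : ℤ), (p : ℤ)]

variable {p M x y}

/-- `ξ' = (x, y; M, p) ∈ SL(2, ℤ)` (`px − My = 1`); `W = ξ' · diag(p, 1)`. [folklore] -/
def xiSL (hbez : (p : ℤ) * x - (M : ℤ) * y = 1) : SL(2, ℤ) :=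
  ⟨!![x, y; (M : ℤ), (p : ℤ)], by rw [Matrix.det_fin_two_of]; linear_combination hbez⟩

/-- `W ∈ GL₂(ℤ[1/p])`: `W = ξ' · diag(p, 1)`. [folklore] -/
def WA (hbez : (p : ℤ) * x - (M : ℤ) * y = 1) : G p := mapGL (A p) (xiSL hbez) * dP1 p

/-- The matrix of `W ∈ GL₂(ℤ[1/p])` is the cast of `Wint`. [folklore] -/
theorem coe_WA (hbez : (p : ℤ) * x - (M : ℤ) * y = 1) :
    ((WA hbez : G p) : Matrix (Fin 2) (Fin 2) (A p)) = (Wint p M x y).map (Int.castRingHom (A p) : ℤ → A p) := by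
  rw [WA, Matrix.GeneralLinearGroup.coe_mul, Matrix.SpecialLinearGroup.mapGL_coe_matrix, xiSL, Wint]
  ext i j
  fin_cases i <;> fin_cases j <;> simp [Matrix.mul_apply, Fin.sum_univ_two, diag2] <;> ring

end Setup

/-! ### Entries of inverses in `GL₂` -/

/-- `(g⁻¹)₁₀ = −det(g)⁻¹ · g₁₀`. [folklore] -/
theorem inv_apply_one_zero (g : G p) :
    ((g⁻¹ : G p) : Matrix (Fin 2) (Fin 2) (A p)) 1 0 =
      -(Ring.inverse (g : Matrix (Fin 2) (Fin 2) (A p)).det * g 1 0) := by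
  rw [Matrix.GeneralLinearGroup.coe_inv, Matrix.inv_def, Matrix.adjugate_fin_two, Matrix.smul_apply,
    smul_eq_mul]
  have h : (!![(g : Matrix (Fin 2) (Fin 2) (A p)) 1 1, -(g : Matrix (Fin 2) (Fin 2) (A p)) 0 1;
      -(g : Matrix (Fin 2) (Fin 2) (A p)) 1 0, (g : Matrix (Fin 2) (Fin 2) (A p)) 0 0] :
        Matrix (Fin 2) (Fin 2) (A p)) 1 0 = -(g : Matrix (Fin 2) (Fin 2) (A p)) 1 0 := rfl
  rw [h]; ring

/-- `(g⁻¹)₀₁ = −det(g)⁻¹ · g₀₁`. [folklore] -/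
theorem inv_apply_zero_one (g : G p) :
    ((g⁻¹ : G p) : Matrix (Fin 2) (Fin 2) (A p)) 0 1 =
      -(Ring.inverse (g : Matrix (Fin 2) (Fin 2) (A p)).det * g 0 1) := by
  rw [Matrix.GeneralLinearGroup.coe_inv, Matrix.inv_def, Matrix.adjugate_fin_two, Matrix.smul_apply,
    smul_eq_mul]
  have h : (!![(g : Matrix (Fin 2) (Fin 2) (A p)) 1 1, -(g : Matrix (Fin 2) (Fin 2) (A p)) 0 1;
      -(g : Matrix (Fin 2) (Fin 2) (A p)) 1 0, (g : Matrix (Fin 2) (Fin 2) (A p)) 0 0] :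
        Matrix (Fin 2) (Fin 2) (A p)) 0 1 = -(g : Matrix (Fin 2) (Fin 2) (A p)) 0 1 := rfl
  rw [h]; ring

/-! ### The subgroups `B* = Stab(∞)`, `P* = Stab(0) ∩ D*`, `D* = Γ₀(M; ℤ[1/p])` of `GL₂(ℤ[1/p])` -/

variable (p) in
/-- `B*`: upper-triangular elements of `GL₂(ℤ[1/p])`. -/
def upperGL : Subgroup (G p) where
  carrier := {g | g 1 0 = 0}
  mul_mem' := by
    intro g h hg hh
    simp only [Set.mem_setOf_eq] at hg hh ⊢
    rw [Matrix.GeneralLinearGroup.coe_mul, Matrix.mul_apply, Fin.sum_univ_two, hg, hh]; ring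
  one_mem' := by simp
  inv_mem' := by
    intro g hg
    simp only [Set.mem_setOf_eq] at hg ⊢
    rw [inv_apply_one_zero, hg]; ring

variable (p) in
/-- `P*_M`: lower-triangular elements of `GL₂(ℤ[1/p])` with lower-left entry in `M·ℤ[1/p]`. -/
def lowerGL (M : ℕ) : Subgroup (G p) where
  carrier := {g | g 0 1 = 0 ∧ ∃ t : A p, g 1 0 = (M : A p) * t}
  mul_mem' := by
    rintro g h ⟨hg, t, ht⟩ ⟨hh, s, hs⟩
    refine ⟨?_, t * h 0 0 + g 1 1 * s, ?_⟩
    · rw [Matrix.GeneralLinearGroup.coe_mul, Matrix.mul_apply, Fin.sum_univ_two, hg, hh]; ring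
    · rw [Matrix.GeneralLinearGroup.coe_mul, Matrix.mul_apply, Fin.sum_univ_two, ht, hs]; ring
  one_mem' := ⟨by simp, 0, by simp⟩
  inv_mem' := by
    rintro g ⟨hg, t, ht⟩
    refine ⟨?_, -(Ring.inverse (g : Matrix (Fin 2) (Fin 2) (A p)).det * t), ?_⟩
    · rw [inv_apply_zero_one, hg]; ring
    · rw [inv_apply_one_zero, ht]; ring

variable (p) in
/-- `D*_M = Γ₀(M; ℤ[1/p])` inside `GL₂(ℤ[1/p])`: lower-left entry in `M·ℤ[1/p]` (ANY unit determinant). -/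
def DeltaGL (M : ℕ) : Subgroup (G p) where
  carrier := {g | ∃ t : A p, g 1 0 = (M : A p) * t}
  mul_mem' := by
    rintro g h ⟨t, ht⟩ ⟨s, hs⟩
    refine ⟨t * h 0 0 + g 1 1 * s, ?_⟩
    rw [Matrix.GeneralLinearGroup.coe_mul, Matrix.mul_apply, Fin.sum_univ_two, ht, hs]; ring
  one_mem' := ⟨0, by simp⟩
  inv_mem' := by
    rintro g ⟨t, ht⟩
    refine ⟨-(Ring.inverse (g : Matrix (Fin 2) (Fin 2) (A p)).det * t), ?_⟩
    rw [inv_apply_one_zero, ht]; ring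

/-- `B* ≤ D*`. [folklore] -/
theorem upperGL_le_DeltaGL (M : ℕ) : upperGL p ≤ DeltaGL p M := by
  intro g hg
  exact ⟨0, by rw [show (g : Matrix (Fin 2) (Fin 2) (A p)) 1 0 = 0 from hg]; ring⟩

/-- `P* ≤ D*`. [folklore] -/
theorem lowerGL_le_DeltaGL (M : ℕ) : lowerGL p M ≤ DeltaGL p M := fun _ hg => hg.2

/-- Diagonal matrices are upper triangular. [folklore] -/
theorem diag2_mem_upperGL (u v : (A p)ˣ) : diag2 u v ∈ upperGL p := by
  show (diag2 u v : G p) 1 0 = 0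
  rfl

/-- Diagonal matrices are lower triangular. [folklore] -/
theorem diag2_mem_lowerGL (M : ℕ) (u v : (A p)ˣ) : diag2 u v ∈ lowerGL p M :=
  ⟨rfl, 0, by simp⟩

/-- The image of `B⁺ ⊆ SL₂(ℤ[1/p])` lies in `B*`. -/
theorem toGL_mem_upperGL {b : SL(2, A p)} (hb : b ∈ upperB p) : (toGL b : G p) ∈ upperGL p := hb

/-- The image of `B⁻_M ⊆ SL₂(ℤ[1/p])` lies in `P*_M`. -/
theorem toGL_mem_lowerGL {M : ℕ} {q : SL(2, A p)} (hq : q ∈ lowerP p M) : (toGL q : G p) ∈ lowerGL p M := hq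

/-- Scalars `pᵏ` lie in `D*`. [folklore] -/
theorem sP_zpow_mem_DeltaGL (M : ℕ) (k : ℤ) : sP p ^ k ∈ DeltaGL p M :=
  (DeltaGL p M).zpow_mem ⟨0, by
    rw [mul_zero, sP, Matrix.GeneralLinearGroup.coe_scalar, Matrix.scalar_apply]
    exact Matrix.diagonal_apply_ne _ (by decide)⟩ k


/-! ### `Γ* = ⟨Γ₀(N), W⟩ ≤ GL₂(ℤ[1/p])` and its normal form `pᵏ · γ · Wⁱ` -/

section GammaStar

variable {N M : ℕ} {x y : ℤ} (hbez : (p : ℤ) * x - (M : ℤ) * y = 1)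

/-- `sP` is central. [folklore] -/
theorem sP_zpow_mul_comm (k : ℤ) (g : G p) : sP p ^ k * g = g * sP p ^ k := by
  have h : Commute (sP p : G p) g := Matrix.GeneralLinearGroup.scalar_commute (pU p) g
  exact (h.zpow_left k).eq

/-- Entries of `mapGL A γ` are the casts of the entries of `γ`. [folklore] -/
theorem coe_mapGL_int (γ : SL(2, ℤ)) :
    ((mapGL (A p) γ : G p) : Matrix (Fin 2) (Fin 2) (A p)) =
      (γ : Matrix (Fin 2) (Fin 2) ℤ).map (Int.castRingHom (A p) : ℤ → A p) := by
  ext i j; simp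

/-- `Γ* := ⟨mapGL Γ₀(N) ∪ {W}⟩ ≤ GL₂(ℤ[1/p])`. -/
def GammaStar (N : ℕ) (hbez : (p : ℤ) * x - (M : ℤ) * y = 1) : Subgroup (G p) :=
  Subgroup.closure (Set.range (fun γ : Gamma0 N ↦ (mapGL (A p) (γ : SL(2, ℤ)) : G p)) ∪ {WA hbez})

/-- `mapGL γ ∈ Γ*`. [folklore] -/
theorem mapGL_mem_GammaStar (γ : Gamma0 N) : (mapGL (A p) (γ : SL(2, ℤ)) : G p) ∈ GammaStar N hbez :=
  Subgroup.subset_closure (Or.inl ⟨γ, rfl⟩)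

/-- `W ∈ Γ*`. [folklore] -/
theorem WA_mem_GammaStar : WA hbez ∈ GammaStar N hbez :=
  Subgroup.subset_closure (Or.inr rfl)

/-- `p·1 ∈ Γ*` once `W² = p γ₀`. [folklore] -/
theorem sP_mem_GammaStar_of (γ₀ : Gamma0 N) (h : WA hbez * WA hbez = sP p * mapGL (A p) (γ₀ : SL(2, ℤ))) :
    (sP p : G p) ∈ GammaStar N hbez := by
  have : (sP p : G p) = WA hbez * WA hbez * (mapGL (A p) (γ₀ : SL(2, ℤ)))⁻¹ := by rw [h, mul_inv_cancel_right]
  rw [this]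
  exact mul_mem (mul_mem (WA_mem_GammaStar hbez) (WA_mem_GammaStar hbez))
    (inv_mem (mapGL_mem_GammaStar hbez γ₀))

/-- `algebraMap ℤ A`-cast of an integer matrix identity `γ' W = W γ` to `GL₂(ℤ[1/p])`. [folklore] -/
theorem mapGL_mul_WA_eq {γ γ' : SL(2, ℤ)}
    (h : (γ' : Matrix (Fin 2) (Fin 2) ℤ) * Wint p M x y = Wint p M x y * (γ : Matrix (Fin 2) (Fin 2) ℤ)) :
    (mapGL (A p) γ' : G p) * WA hbez = WA hbez * mapGL (A p) γ := by
  rw [← Units.val_inj, Units.val_mul, Units.val_mul, coe_WA, coe_mapGL_int, coe_mapGL_int,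
    ← RingHom.mapMatrix_apply, ← RingHom.mapMatrix_apply, ← RingHom.mapMatrix_apply, ← map_mul,
    ← map_mul, h]

/-- Cast of `W W = p γ₀` to `GL₂(ℤ[1/p])`: `W W = (p·1) γ₀`. [folklore] -/
theorem WA_mul_WA_eq {γ₀ : SL(2, ℤ)}
    (h : Wint p M x y * Wint p M x y = (p : ℤ) • (γ₀ : Matrix (Fin 2) (Fin 2) ℤ)) :
    WA hbez * WA hbez = sP p * (mapGL (A p) γ₀ : G p) := by
  rw [← Units.val_inj, Units.val_mul, Units.val_mul, coe_WA, coe_mapGL_int, ← RingHom.mapMatrix_apply,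
    ← RingHom.mapMatrix_apply, ← map_mul, h, sP, Matrix.GeneralLinearGroup.coe_scalar, coe_pU,
    map_zsmul, RingHom.mapMatrix_apply, Matrix.scalar_apply, ← Matrix.smul_eq_diagonal_mul]
  ext i j
  simp [Matrix.smul_apply]

variable (hconj : ∀ γ : Gamma0 N, ∃ γ' : Gamma0 N,
    ((γ' : SL(2, ℤ)) : Matrix (Fin 2) (Fin 2) ℤ) * Wint p M x y = Wint p M x y * ((γ : SL(2, ℤ)) : Matrix _ _ ℤ))
  (hsq : ∃ γ₀ : Gamma0 N, Wint p M x y * Wint p M x y = (p : ℤ) • ((γ₀ : SL(2, ℤ)) : Matrix (Fin 2) (Fin 2) ℤ))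
include hconj hsq

/-- **Normal form**: every element of `Γ*` is `pᵏ · γ · Wⁱ` (`W γ = γ^W W`, `W² = p γ₀`). [folklore] -/
theorem exists_normalForm_of_mem {g : G p} (hg : g ∈ GammaStar N hbez) :
    ∃ (k : ℤ) (γ : Gamma0 N) (i : ℕ), i ≤ 1 ∧ g = sP p ^ k * mapGL (A p) (γ : SL(2, ℤ)) * WA hbez ^ i := by
  obtain ⟨γ₀, hγ₀⟩ := hsq
  have hWW : WA hbez * WA hbez = sP p * (mapGL (A p) (γ₀ : SL(2, ℤ)) : G p) := WA_mul_WA_eq hbez hγ₀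
  have hWinv : (WA hbez)⁻¹ = sP p ^ (-1 : ℤ) * (mapGL (A p) ((γ₀⁻¹ : Gamma0 N) : SL(2, ℤ)) : G p) * WA hbez := by
    have h1 : (sP p * (mapGL (A p) (γ₀ : SL(2, ℤ)) : G p))⁻¹ * (WA hbez * WA hbez) = 1 := by
      rw [hWW, inv_mul_cancel]
    calc (WA hbez)⁻¹ = (sP p * (mapGL (A p) (γ₀ : SL(2, ℤ)) : G p))⁻¹ * (WA hbez * WA hbez) * (WA hbez)⁻¹ := by
          rw [h1, one_mul]
      _ = (sP p * (mapGL (A p) (γ₀ : SL(2, ℤ)) : G p))⁻¹ * WA hbez := by rw [mul_assoc, mul_inv_cancel_right]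
      _ = sP p ^ (-1 : ℤ) * (mapGL (A p) ((γ₀⁻¹ : Gamma0 N) : SL(2, ℤ)) : G p) * WA hbez := by
          rw [mul_inv_rev, Subgroup.coe_inv, map_inv]
          congr 1
          have h2 := sP_zpow_mul_comm (-1) ((mapGL (A p) (γ₀ : SL(2, ℤ)) : G p)⁻¹)
          rw [zpow_neg_one] at h2 ⊢
          exact h2.symm
  refine Subgroup.closure_induction (p := fun g _ ↦
    ∃ (k : ℤ) (γ : Gamma0 N) (i : ℕ), i ≤ 1 ∧ g = sP p ^ k * mapGL (A p) (γ : SL(2, ℤ)) * WA hbez ^ i)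
    ?_ ?_ ?_ ?_ hg
  · rintro g (⟨γ, rfl⟩ | rfl)
    · exact ⟨0, γ, 0, zero_le_one, by simp⟩
    · exact ⟨0, 1, 1, le_rfl, by simp⟩
  · exact ⟨0, 1, 0, zero_le_one, by simp⟩
  · rintro g h - - ⟨k, γ, i, hi, rfl⟩ ⟨l, γ', j, hj, rfl⟩
    interval_cases i
    · refine ⟨k + l, γ * γ', j, hj, ?_⟩
      simp only [pow_zero, mul_one, Subgroup.coe_mul, map_mul, zpow_add, mul_assoc]
      rw [← mul_assoc (mapGL (A p) (γ : SL(2, ℤ)) : G p) (sP p ^ l), ← sP_zpow_mul_comm l, mul_assoc]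
    · obtain ⟨γ'', hγ''⟩ := hconj γ'
      have hc : WA hbez * (mapGL (A p) (γ' : SL(2, ℤ)) : G p) = mapGL (A p) (γ'' : SL(2, ℤ)) * WA hbez :=
        (mapGL_mul_WA_eq hbez hγ'').symm
      interval_cases j
      · refine ⟨k + l, γ * γ'', 1, le_rfl, ?_⟩
        simp only [pow_zero, mul_one, pow_one, Subgroup.coe_mul, map_mul, zpow_add, mul_assoc]
        rw [← mul_assoc (WA hbez) (sP p ^ l), ← sP_zpow_mul_comm l (WA hbez), mul_assoc, hc,
          ← mul_assoc (mapGL (A p) (γ : SL(2, ℤ)) : G p) (sP p ^ l), ← sP_zpow_mul_comm l, mul_assoc]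
      · refine ⟨k + l + 1, γ * γ'' * γ₀, 0, zero_le_one, ?_⟩
        simp only [pow_zero, mul_one, pow_one, Subgroup.coe_mul, map_mul, zpow_add, zpow_one, mul_assoc]
        rw [← mul_assoc (WA hbez) (sP p ^ l), ← sP_zpow_mul_comm l (WA hbez), mul_assoc,
          ← mul_assoc (WA hbez) (mapGL (A p) (γ' : SL(2, ℤ)) : G p), hc, mul_assoc, hWW,
          ← mul_assoc (mapGL (A p) (γ : SL(2, ℤ)) : G p) (sP p ^ l), ← sP_zpow_mul_comm l, mul_assoc,
          ← mul_assoc (mapGL (A p) (γ'' : SL(2, ℤ)) : G p) (sP p), ← zpow_one (sP p), ← sP_zpow_mul_comm 1,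
          mul_assoc, ← mul_assoc (mapGL (A p) (γ : SL(2, ℤ)) : G p) (sP p ^ (1 : ℤ)), ← sP_zpow_mul_comm 1,
          mul_assoc]
  · rintro g - ⟨k, γ, i, hi, rfl⟩
    interval_cases i
    · refine ⟨-k, γ⁻¹, 0, zero_le_one, ?_⟩
      simp only [pow_zero, mul_one, mul_inv_rev, Subgroup.coe_inv, map_inv, ← zpow_neg]
      rw [sP_zpow_mul_comm]
    · obtain ⟨γ'', hγ''⟩ := hconj γ⁻¹
      have hc : WA hbez * (mapGL (A p) ((γ⁻¹ : Gamma0 N) : SL(2, ℤ)) : G p) =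
          mapGL (A p) (γ'' : SL(2, ℤ)) * WA hbez :=
        (mapGL_mul_WA_eq hbez hγ'').symm
      refine ⟨-k + -1, γ₀⁻¹ * γ'', 1, le_rfl, ?_⟩
      simp only [pow_one, mul_inv_rev, Subgroup.coe_mul, map_mul, zpow_add]
      rw [hWinv, ← map_inv, ← Subgroup.coe_inv, ← zpow_neg]
      simp only [mul_assoc]
      rw [← mul_assoc (WA hbez) (mapGL (A p) ((γ⁻¹ : Gamma0 N) : SL(2, ℤ)) : G p) (sP p ^ (-k)), hc,
        mul_assoc (mapGL (A p) (γ'' : SL(2, ℤ)) : G p) (WA hbez) (sP p ^ (-k)),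
        ← sP_zpow_mul_comm (-k) (WA hbez),
        ← mul_assoc (mapGL (A p) (γ'' : SL(2, ℤ)) : G p) (sP p ^ (-k)), ← sP_zpow_mul_comm (-k), mul_assoc,
        ← mul_assoc (mapGL (A p) ((γ₀⁻¹ : Gamma0 N) : SL(2, ℤ)) : G p) (sP p ^ (-k)), ← sP_zpow_mul_comm (-k),
        mul_assoc, ← mul_assoc (sP p ^ (-1 : ℤ)) (sP p ^ (-k)), ← zpow_add, add_comm, zpow_add, mul_assoc]

omit hconj hsq in
/-- Normal forms lie in `Γ*` (given `p·1 ∈ Γ*`). [folklore] -/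
theorem mem_of_normalForm (hsP : (sP p : G p) ∈ GammaStar N hbez) (k : ℤ) (γ : Gamma0 N) (i : ℕ) :
    sP p ^ k * mapGL (A p) (γ : SL(2, ℤ)) * WA hbez ^ i ∈ GammaStar N hbez := by
  exact mul_mem (mul_mem (Subgroup.zpow_mem _ hsP k) (mapGL_mem_GammaStar hbez γ))
    (pow_mem (WA_mem_GammaStar hbez) i)

end GammaStar

end

end Summit.BirchSwinnertonDyer.BirchSwinnertonDyer.Theorems.MultOrbit
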